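import Summits.QuantumFields.YangMills.Theorems.BalabanUVNodesN15TwoGridMeanZeroMultiplierL2
import Summits.QuantumFields.YangMills.Theorems.BalabanUVNodesN15TwoGridEntry2
import Summits.QuantumFields.YangMills.Theorems.BalabanUVNodesN15TwoGridFirstOrderLetters
import HarnessLib

/-!
# N15 (NE2) — PROGRAMME K, part K-I: ★★★ THE CELL-OSCILLATION ROW OF `∇′_νΔ′_a⁻¹` FOR THE PAIR OF RECORD IN SUP-BLOCK CURRENCY, HYPOTHESIS-FREE — K-E's L²-block row upgraded to the sup
# entry by parts 70∕56's sub-box interpolation: `(ρ′(sD′_ν)∘Δ′_a⁻¹)∘𝔇_{kingPrV}(M_{c′}, M_{blockAvg c′}) ≤ C·r·(L^k)^{−1∕(8(d+1))}·e^{−δ|y−y′|_T}` — III-B's ninth row `hDGc` for Bałaban's pair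

WHO ∕ WHEN.  Cell `pub-ymgap`, seat `pub-ymgap-dag-n15-a` (KNIT-BY-NAME seat of Track-A DAG node N15 = NE2, g25); `--kind proof --supports stmt-QuantumFields-27366 --as helper` (K3⁸;
count-neutral).  THEOREMS ONLY (0 `def`).  Over K-E `…TwoGridMeanZeroMultiplierL2` (★★★ `hasMajL2_gGrad_comp_idef_mulOp_blockAvg`), part 70 `…TwoGridBoxAvg` (★★ `hasMaj_sup_of_l2Blocks_osc`),
part 56 `…TwoGridHolderSteps` (`hasMaj_holderSteps_pair`: Bałaban's (1.111) Hölder steps of `∇G`), part 71 `…TwoGridEntry2` (`sqrt_pow_mul_rpow_le`, `pow_rpow_neg_half_le`), part 42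
(`ineq110_114_pair`, `hasMaj_grad_of_ineq`), part 58 (`hasMaj_comp_pull_kingPrV`), II-B (`hasMaj_comp_diagK_const`), n15-b (`abs_blockAvg_le`), `T4EtaRateCoeffDefect.hasMaj_idef_mulOp` BY NAME;
nothing in the tree is modified.

WHY.  III-B (`hasMaj_idef_bgPair_of_sandwichRows`, sup currency) needs the `c′`-defect row under the fronts `∇′_νG′` in SUP-block currency; for the pair of record K-E produced it in (sup →
L²-block) currency (the mixed row «∇G∇*» is Bałaban's (1.114) entry, bounded in L² where its sup row is `≍ log n′`).  The upgrade to the sup entry needs NO jet and NO level decomposition: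
the shifts act on the OUTPUT of `∇′G′`, so the sub-box oscillations are the (1.111) Hölder steps of `∇′G′` (part 56) composed with the bounded diagonal `𝔇(M_{c′}, M_{c̄}) ≤ 2r·𝟙`; part 70's
`sup ≤ √(#sub-boxes)·L² + oscillation` with sub-boxes of physical side `L^{−⌊k∕4(d+1)⌋}` gives the rate `(L^k)^{−1∕(8(d+1))}` exactly as part 71 did for entry 2.

WHAT.  §13 ★★★ `hasMaj_gGrad_comp_idef_mulOp_blockAvg (hLodd : Odd L) (hL2 : 2 ≤ L) (ha : 0 < a) : ∃ δ C > 0, ∀ m_T k m (1 ≤ k) (hL) ν c′ r, 0 ≤ r → |c′| ≤ r →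
HasMaj (ofBlocks (unitTorusGeo L k M) (blkFine L k M)) (ofBlocks (unitTorusGeo L k M) (blockOf (L^m·L^k) M ∘ fst)) ((ρ′(sD′_ν n′)∘Δ′_a⁻¹)∘𝔇_{kingPrV}(M_{c′}, M_{blockAvg c′}))
(C·r·(L^k)^{−1∕(8(d+1))}·e^{−δ|y−y′|_T})`, `M = MP (paramsOf d L m_T k hL)` — HYPOTHESIS-FREE, uniform in `m`, NO letter on `∇c′`, NO fit of `c′`.
HONEST FRAMING ∕ LIMITS.  `U ≡ 1` Landau-gauge pair on the torus family of record; abelianised scalar multipliers, (C3) block-average transport; the exponent `1∕(8(d+1))` is the interpolation's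
currency artefact (K-E's L² row has the full `L^{−k}`); NE2⁺ NOT printed ∕ NOT proved; no statement of record touched; N15 NOT discharged; K3⁸ OPEN; counts UNMOVED (typed 28∕28 · discharged
5∕27); one finite torus per index — NOT ℝ⁴ ∕ infinite volume ∕ OS ∕ mass gap ∕ Clay.  ONE declared `set_option maxHeartbeats 800000 in` on ★★★ (the interpolation's
long-operator bookkeeping).
-/

noncomputable section

open scoped BigOperators
open Finset

namespace Summit.QuantumFields.YangMills.BalabanUVNodes.N15.TwoGrid

open Literature.MathematicalPhysics.QuantumFieldTheory.Balaban1983to89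
open Literature.MathematicalPhysics.QuantumFieldTheory.Balaban1983to89.B11SectG (BlockNorm HasMaj)
open Literature.MathematicalPhysics.QuantumFieldTheory.Balaban1983to89.T4EtaRateDefect (idef)
open Literature.MathematicalPhysics.QuantumFieldTheory.Balaban1983to89.T4EtaRateCoeffDefect (pull diagK blockAvg hasMaj_idef_mulOp)
open Literature.MathematicalPhysics.QuantumFieldTheory.Balaban1983to89.B6Prop26Gluing (mulOp)
open Literature.MathematicalPhysics.QuantumFieldTheory.Balaban1983to89.B5Prop11Plancherel (Tor fine)
open Literature.MathematicalPhysics.QuantumFieldTheory.Balaban1983to89.B5SettingP12Real (latticeSettingP12R)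
open Literature.MathematicalPhysics.QuantumFieldTheory.Balaban1983to89.B5SettingP12Weighted (etaPow etaPow_nonneg)
open Literature.MathematicalPhysics.QuantumFieldTheory.Balaban1983to89.B5SiteBridgeP12 (MP)
open Literature.MathematicalPhysics.QuantumFieldTheory.King1986.Torus (blockOf tdistT tdistT_nonneg)
open Literature.MathematicalPhysics.QuantumFieldTheory.Balaban1983to89.B6UnitTorusCarrier (unitTorusGeo)
open Summit.QuantumFields.YangMills.BalabanUVNodes.N15.VectorPiece (blkFine kingPrV blkFine_comp_kingPrV)
open Summit.QuantumFields.YangMills.BalabanUVNodes.N15.BackgroundLayer (abs_blockAvg_le)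

variable (d : ℕ) {L : ℕ} [NeZero L]

/-! ## §13 ★★★ The sup upgrade of K-E's row -/

set_option maxHeartbeats 800000 in
/-- ★★★ **THE CELL-OSCILLATION ROW OF `∇′_νΔ′_a⁻¹` FOR THE PAIR OF RECORD, SUP-BLOCK CURRENCY, HYPOTHESIS-FREE** — III-B's `hDGc` at `G′ := Δ′_a⁻¹`.  See the module docstring (WHAT ∕ WHY).
[cite: Balaban1984PropagatorsI, Prop. 1.2 (1.111) p.35 (Hölder steps of ∇G), (1.114) p.36 (‖ζ∇GΔ*J‖); Balaban1985BackgroundPropagators, (3.35) p.396, (3.52) p.400, Thm 3.1 (3.42) p.397 (the row's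
consumer); King1986, p.664 (pairing), Prop. 3.9 (3.73) p.665 (rate factor)] -/
theorem hasMaj_gGrad_comp_idef_mulOp_blockAvg (hLodd : Odd L) (hL2 : 2 ≤ L) {a : ℝ} (ha : 0 < a) :
    ∃ δ C : ℝ, 0 < δ ∧ 0 < C ∧ ∀ (mT k m : ℕ) (hk : 1 ≤ k) (hL : Odd L ∧ 1 < L) (ν : Fin (d + 1))
      (c' : Tor (fine (L ^ m * L ^ k) (MP (paramsOf d L mT k hL))) × Fin (d + 1) → ℝ) (r : ℝ), 0 ≤ r → (∀ z, |c' z| ≤ r) →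
      HasMaj (BlockNorm.ofBlocks (unitTorusGeo L k (MP (paramsOf d L mT k hL))) (blkFine L k (MP (paramsOf d L mT k hL))))
        (BlockNorm.ofBlocks (unitTorusGeo L k (MP (paramsOf d L mT k hL)))
          (fun z : Tor (fine (L ^ m * L ^ k) (MP (paramsOf d L mT k hL))) × Fin (d + 1) => blockOf (L ^ m * L ^ k) (MP (paramsOf d L mT k hL)) z.1))
        ((symbOp (MP (paramsOf d L mT k hL)) (L ^ m * L ^ k) (sD (MP (paramsOf d L mT k hL)) (L ^ m * L ^ k) ν (L ^ m * L ^ k : ℕ)) ∘ₗ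
            gOp (MP (paramsOf d L mT k hL)) (L ^ m * L ^ k) a) ∘ₗ
          idef (pull (kingPrV L k m (MP (paramsOf d L mT k hL)))) (pull (kingPrV L k m (MP (paramsOf d L mT k hL))))
            (mulOp c') (mulOp (blockAvg (kingPrV L k m (MP (paramsOf d L mT k hL))) c')))
        (fun y y' => C * r * ((L ^ k : ℕ) : ℝ) ^ (-(1 / (8 * ((d : ℝ) + 1)))) * Real.exp (-(δ * tdistT (MP (paramsOf d L mT k hL)) y y'))) := by
  classical
  have hL : Odd L ∧ 1 < L := ⟨hLodd, by omega⟩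
  have hL0 : 0 < L := by omega
  have hLr1 : (1 : ℝ) ≤ (L : ℝ) := by exact_mod_cast (show 1 ≤ L by omega)
  have hLr0 : (0 : ℝ) < (L : ℝ) := by linarith
  obtain ⟨δ₂, C₂, hδ₂, hC₂, HE⟩ := hasMajL2_gGrad_comp_idef_mulOp_blockAvg d hL ha
  obtain ⟨δ₄, C₄, hδ₄, hC₄, HH⟩ := hasMaj_holderSteps_pair (d := d) hL ha (α := 1 / 2) (by norm_num) (by norm_num)
  obtain ⟨δ₅, C₀, Cα, Cε, Cαε, hδ₅, hC₀, H5⟩ := ineq110_114_pair (d := d) hL ha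
  obtain ⟨δ, hδ⟩ : ∃ δ : ℝ, δ = min δ₂ (min δ₄ δ₅) := ⟨_, rfl⟩
  have hδpos : 0 < δ := by rw [hδ]; exact lt_min hδ₂ (lt_min hδ₄ hδ₅)
  have hδ2 : δ ≤ δ₂ := by rw [hδ]; exact min_le_left _ _
  have hδ4 : δ ≤ δ₄ := by rw [hδ]; exact (min_le_right _ _).trans (min_le_left _ _)
  have hδ5 : δ ≤ δ₅ := by rw [hδ]; exact (min_le_right _ _).trans (min_le_right _ _)
  obtain ⟨Cbig, hCbig⟩ : ∃ Cbig : ℝ, Cbig = C₂ + 2 * ((d : ℝ) + 1) * Real.exp δ ^ (d + 1) * (2 * C₄ * (L : ℝ) ^ (1 / 2 : ℝ)) + 2 * C₀ * L := ⟨_, rfl⟩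
  have hCbig0 : 0 ≤ Cbig := by rw [hCbig]; positivity
  refine ⟨δ, Cbig + 1, hδpos, by positivity, fun mT k m hk hL' ν c' r hr hc' => ?_⟩
  haveI : NeZero (L ^ k) := ⟨pow_ne_zero k (by omega)⟩
  have hn1 : 1 ≤ L ^ k := Nat.one_le_pow _ _ hL0
  have hn'1 : 1 ≤ L ^ m * L ^ k := Nat.one_le_iff_ne_zero.mpr (NeZero.ne _)
  have hn0 : (0 : ℝ) < ((L ^ k : ℕ) : ℝ) := by exact_mod_cast hn1
  have hnr1 : (1 : ℝ) ≤ ((L ^ k : ℕ) : ℝ) := by exact_mod_cast hn1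
  have hncast : ((L ^ k : ℕ) : ℝ) = (L : ℝ) ^ k := by push_cast; ring
  obtain ⟨rt, hrt⟩ : ∃ rt : ℝ, rt = ((L ^ k : ℕ) : ℝ) ^ (-(1 / (8 * ((d : ℝ) + 1)))) := ⟨_, rfl⟩
  have hrt0 : 0 ≤ rt := by rw [hrt]; exact Real.rpow_nonneg hn0.le _
  have hrtx : (((L ^ k : ℕ) : ℝ))⁻¹ ≤ rt := by
    rw [hrt, ← Real.rpow_neg_one]
    exact Real.rpow_le_rpow_of_exponent_le hnr1 (by rw [neg_le_neg_iff]; rw [div_le_one (by positivity)]; have : (0:ℝ) ≤ d := Nat.cast_nonneg d; nlinarith)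
  have hE : ∀ y y' : Tor (MP (paramsOf d L mT k hL')), 0 ≤ Real.exp (-(δ * tdistT (MP (paramsOf d L mT k hL')) y y')) := fun _ _ => Real.exp_nonneg _
  -- the bounded diagonal `𝔇(M_{c′}, M_{c̄}) ≤ diagK 2r` (no rate — none is needed for the oscillations)
  have hblk : blkFine L k (MP (paramsOf d L mT k hL')) ∘ kingPrV L k m (MP (paramsOf d L mT k hL')) =
      fun i : Tor (fine (L ^ m * L ^ k) (MP (paramsOf d L mT k hL'))) × Fin (d + 1) => blockOf (L ^ m * L ^ k) (MP (paramsOf d L mT k hL')) i.1 := blkFine_comp_kingPrV _ L k m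
  have hfit : HasMaj (BlockNorm.ofBlocks (unitTorusGeo L k (MP (paramsOf d L mT k hL'))) (blkFine L k (MP (paramsOf d L mT k hL'))))
      (BlockNorm.ofBlocks (unitTorusGeo L k (MP (paramsOf d L mT k hL')))
        (fun z : Tor (fine (L ^ m * L ^ k) (MP (paramsOf d L mT k hL'))) × Fin (d + 1) => blockOf (L ^ m * L ^ k) (MP (paramsOf d L mT k hL')) z.1))
      (idef (pull (kingPrV L k m (MP (paramsOf d L mT k hL')))) (pull (kingPrV L k m (MP (paramsOf d L mT k hL')))) (mulOp c')
        (mulOp (blockAvg (kingPrV L k m (MP (paramsOf d L mT k hL'))) c'))) (diagK fun _ => 2 * r) := by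
    have h := hasMaj_idef_mulOp (g := unitTorusGeo L k (MP (paramsOf d L mT k hL'))) (blkFine L k (MP (paramsOf d L mT k hL'))) (kingPrV L k m (MP (paramsOf d L mT k hL')))
      (a' := c') (a := blockAvg (kingPrV L k m (MP (paramsOf d L mT k hL'))) c') (o := fun _ => 2 * r) (fun _ => by positivity) fun z => by
        have h1 := hc' z
        have h2 := abs_blockAvg_le (kingPrV L k m (MP (paramsOf d L mT k hL'))) hr hc' (kingPrV L k m (MP (paramsOf d L mT k hL')) z)
        calc |c' z - blockAvg (kingPrV L k m (MP (paramsOf d L mT k hL'))) c' (kingPrV L k m (MP (paramsOf d L mT k hL')) z)|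
            ≤ |c' z| + |blockAvg (kingPrV L k m (MP (paramsOf d L mT k hL'))) c' (kingPrV L k m (MP (paramsOf d L mT k hL')) z)| := abs_sub _ _
          _ ≤ 2 * r := by linarith
    rw [hblk] at h
    exact h
  have HP' := (H5 mT k m hk).2
  by_cases hkD : 8 * (d + 1) ≤ k
  · -- sub-boxes of side `ℓ = L^m·L^{k−j₀}`, `j₀ = ⌊k∕(4(d+1))⌋ ≥ 2`
    obtain ⟨j₀, hj₀⟩ : ∃ j₀ : ℕ, j₀ = k / (4 * (d + 1)) := ⟨_, rfl⟩
    have hj₀2 : 2 ≤ j₀ := by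
      rw [hj₀]; exact (Nat.le_div_iff_mul_le (by positivity)).mpr (by linarith)
    have hj₀k : j₀ ≤ k := by rw [hj₀]; exact Nat.div_le_self k (4 * (d + 1))
    have h4j : 4 * (j₀ * (d + 1)) ≤ k := by
      have := Nat.div_mul_le_self k (4 * (d + 1))
      rw [hj₀]; nlinarith [this]
    have hklt : k < 4 * (d + 1) * (j₀ + 1) := by rw [hj₀]; exact Nat.lt_mul_div_succ k (by positivity)
    obtain ⟨ℓ, hℓ⟩ : ∃ ℓ : ℕ, ℓ = L ^ m * L ^ (k - j₀) := ⟨_, rfl⟩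
    have hkj : L ^ (k - j₀) * L ^ j₀ = L ^ k := by rw [← pow_add, Nat.sub_add_cancel hj₀k]
    have hLj4 : 4 ≤ L ^ j₀ := le_trans (by nlinarith : 4 ≤ L ^ 2) (Nat.pow_le_pow_right hL0 hj₀2)
    have hℓ1 : 1 ≤ ℓ := by rw [hℓ]; exact Nat.one_le_iff_ne_zero.mpr (Nat.mul_ne_zero (pow_ne_zero m (by omega)) (pow_ne_zero _ (by omega)))
    have hℓfac : L ^ m * L ^ k = ℓ * L ^ j₀ := by rw [hℓ, mul_assoc, hkj]
    have hℓn : ℓ ∣ L ^ m * L ^ k := ⟨L ^ j₀, hℓfac⟩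
    have h4ℓ : 4 * ℓ ≤ L ^ m * L ^ k := by
      calc 4 * ℓ = L ^ m * (L ^ (k - j₀) * 4) := by rw [hℓ]; ring
        _ ≤ L ^ m * (L ^ (k - j₀) * L ^ j₀) := Nat.mul_le_mul_left _ (Nat.mul_le_mul_left _ hLj4)
        _ = L ^ m * L ^ k := by rw [hkj]
    have hquot : (L ^ m * L ^ k) / ℓ = L ^ j₀ := by
      rw [hℓfac, Nat.mul_div_cancel_left _ (by omega)]
    -- K-E's L²-block row, weakened to `(L^k)^{−1∕4}` and the common rate
    have h2 : HasMaj (BlockNorm.ofBlocks (unitTorusGeo L k (MP (paramsOf d L mT k hL'))) (blkFine L k (MP (paramsOf d L mT k hL'))))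
        (BlockNorm.l2Blocks (unitTorusGeo L k (MP (paramsOf d L mT k hL')))
          (fun z : Tor (fine (L ^ m * L ^ k) (MP (paramsOf d L mT k hL'))) × Fin (d + 1) => blockOf (L ^ m * L ^ k) (MP (paramsOf d L mT k hL')) z.1)
          (etaPow (L ^ m * L ^ k) (d + 1)) (etaPow_nonneg _ _))
        ((symbOp (MP (paramsOf d L mT k hL')) (L ^ m * L ^ k) (sD (MP (paramsOf d L mT k hL')) (L ^ m * L ^ k) ν (L ^ m * L ^ k : ℕ)) ∘ₗ
            gOp (MP (paramsOf d L mT k hL')) (L ^ m * L ^ k) a) ∘ₗ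
          idef (pull (kingPrV L k m (MP (paramsOf d L mT k hL')))) (pull (kingPrV L k m (MP (paramsOf d L mT k hL')))) (mulOp c')
            (mulOp (blockAvg (kingPrV L k m (MP (paramsOf d L mT k hL'))) c')))
        (fun y y' => C₂ * r * ((L ^ k : ℕ) : ℝ) ^ (-((1 : ℝ) / 2 / 2)) * Real.exp (-(δ * tdistT (MP (paramsOf d L mT k hL')) y y'))) := by
      refine (HE mT k m hk ν c' r hr hc').mono fun y y' => ?_
      have hx4 : (((L ^ k : ℕ) : ℝ))⁻¹ ≤ ((L ^ k : ℕ) : ℝ) ^ (-((1 : ℝ) / 2 / 2)) := by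
        rw [← Real.rpow_neg_one]; exact Real.rpow_le_rpow_of_exponent_le hnr1 (by norm_num)
      exact mul_le_mul (mul_le_mul_of_nonneg_left hx4 (mul_nonneg hC₂.le hr))
        (Real.exp_le_exp.mpr (neg_le_neg (mul_le_mul_of_nonneg_right hδ2 (tdistT_nonneg _ y y')))) (Real.exp_nonneg _) (by positivity)
    -- the oscillations: Hölder steps of `∇′G′` on the bounded diagonal
    have hosc : ∀ (i : Fin (d + 1)) (t : ℕ), t < ℓ → HasMaj (BlockNorm.ofBlocks (unitTorusGeo L k (MP (paramsOf d L mT k hL'))) (blkFine L k (MP (paramsOf d L mT k hL'))))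
        (BlockNorm.ofBlocks (unitTorusGeo L k (MP (paramsOf d L mT k hL'))) (fun z : Tor (fine (L ^ m * L ^ k) (MP (paramsOf d L mT k hL'))) × Fin (d + 1) => blockOf (L ^ m * L ^ k) (MP (paramsOf d L mT k hL')) z.1))
        (symbOp (MP (paramsOf d L mT k hL')) (L ^ m * L ^ k) (sT (MP (paramsOf d L mT k hL')) (L ^ m * L ^ k) i ^ t - 1) ∘ₗ
          ((symbOp (MP (paramsOf d L mT k hL')) (L ^ m * L ^ k) (sD (MP (paramsOf d L mT k hL')) (L ^ m * L ^ k) ν (L ^ m * L ^ k : ℕ)) ∘ₗ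
              gOp (MP (paramsOf d L mT k hL')) (L ^ m * L ^ k) a) ∘ₗ
            idef (pull (kingPrV L k m (MP (paramsOf d L mT k hL')))) (pull (kingPrV L k m (MP (paramsOf d L mT k hL')))) (mulOp c')
              (mulOp (blockAvg (kingPrV L k m (MP (paramsOf d L mT k hL'))) c'))))
        (fun y y' => 2 * C₄ * r * ((ℓ : ℝ) / ((L ^ m * L ^ k : ℕ) : ℝ)) ^ (1 / 2 : ℝ) * Real.exp (-(δ * tdistT (MP (paramsOf d L mT k hL')) y y'))) := by
      intro i t ht
      have h4t : 4 * t ≤ L ^ m * L ^ k := le_trans (Nat.mul_le_mul_left 4 ht.le) h4ℓ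
      have hH := (HH mT k m hk i ν t).2 h4t
      have hcomp := hasMaj_comp_diagK_const (g := unitTorusGeo L k (MP (paramsOf d L mT k hL'))) _ (blkFine L k (MP (paramsOf d L mT k hL')))
        (mul_nonneg hC₄.le (Real.rpow_nonneg (div_nonneg (Nat.cast_nonneg _) (Nat.cast_nonneg _)) _)) hH hfit
      rw [LinearMap.comp_assoc] at hcomp
      refine hcomp.mono fun y y' => ?_
      have htl : ((t : ℝ) / ((L ^ m * L ^ k : ℕ) : ℝ)) ^ (1 / 2 : ℝ) ≤ ((ℓ : ℝ) / ((L ^ m * L ^ k : ℕ) : ℝ)) ^ (1 / 2 : ℝ) :=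
        Real.rpow_le_rpow (div_nonneg (Nat.cast_nonneg _) (Nat.cast_nonneg _)) (div_le_div_of_nonneg_right (by exact_mod_cast ht.le) (Nat.cast_nonneg _)) (by norm_num)
      calc C₄ * ((t : ℝ) / ((L ^ m * L ^ k : ℕ) : ℝ)) ^ (1 / 2 : ℝ) * (2 * r) * Real.exp (-(δ₄ * tdistT (MP (paramsOf d L mT k hL')) y y'))
          ≤ C₄ * ((ℓ : ℝ) / ((L ^ m * L ^ k : ℕ) : ℝ)) ^ (1 / 2 : ℝ) * (2 * r) * Real.exp (-(δ * tdistT (MP (paramsOf d L mT k hL')) y y')) :=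
            mul_le_mul (mul_le_mul_of_nonneg_right (mul_le_mul_of_nonneg_left htl hC₄.le) (by positivity))
              (Real.exp_le_exp.mpr (neg_le_neg (mul_le_mul_of_nonneg_right hδ4 (tdistT_nonneg _ y y')))) (Real.exp_nonneg _) (by positivity)
        _ = 2 * C₄ * r * ((ℓ : ℝ) / ((L ^ m * L ^ k : ℕ) : ℝ)) ^ (1 / 2 : ℝ) * Real.exp (-(δ * tdistT (MP (paramsOf d L mT k hL')) y y')) := by ring
    have hmain := hasMaj_sup_of_l2Blocks_osc (MP (paramsOf d L mT k hL')) k (L ^ m * L ^ k) hℓ1 hℓn (B₂ := C₂ * r * ((L ^ k : ℕ) : ℝ) ^ (-((1 : ℝ) / 2 / 2)))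
      (Bosc := 2 * C₄ * r * ((ℓ : ℝ) / ((L ^ m * L ^ k : ℕ) : ℝ)) ^ (1 / 2 : ℝ))
      (by positivity) hδpos.le h2 hosc
    refine hmain.mono fun y y' => mul_le_mul_of_nonneg_right ?_ (hE y y')
    -- rate bookkeeping (part 71's)
    rw [hquot, ← hrt]
    have hsq : Real.sqrt ((((L ^ j₀ : ℕ) : ℝ)) ^ (d + 1)) = Real.sqrt ((L : ℝ) ^ (j₀ * (d + 1))) := by
      push_cast; rw [← pow_mul]
    have h1 : Real.sqrt ((((L ^ j₀ : ℕ) : ℝ)) ^ (d + 1)) * (C₂ * r * ((L ^ k : ℕ) : ℝ) ^ (-((1 : ℝ) / 2 / 2))) ≤ C₂ * r * rt := by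
      rw [hsq, hncast, show (-((1 : ℝ) / 2 / 2)) = -(1 / 4 : ℝ) by norm_num]
      have hs := sqrt_pow_mul_rpow_le hLr1 h4j
      have hrt' : ((L : ℝ) ^ k) ^ (-(1 / 8 : ℝ)) ≤ rt := by
        rw [hrt, hncast]
        exact Real.rpow_le_rpow_of_exponent_le (one_le_pow₀ hLr1) (by
          rw [neg_le_neg_iff, one_div_le_one_div (by positivity) (by norm_num)]; have : (0 : ℝ) ≤ d := Nat.cast_nonneg d; nlinarith)
      calc Real.sqrt ((L : ℝ) ^ (j₀ * (d + 1))) * (C₂ * r * ((L : ℝ) ^ k) ^ (-(1 / 4 : ℝ)))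
          = C₂ * r * (Real.sqrt ((L : ℝ) ^ (j₀ * (d + 1))) * ((L : ℝ) ^ k) ^ (-(1 / 4 : ℝ))) := by ring
        _ ≤ C₂ * r * rt := mul_le_mul_of_nonneg_left (hs.trans hrt') (mul_nonneg hC₂.le hr)
    have h2' : ((ℓ : ℝ) / ((L ^ m * L ^ k : ℕ) : ℝ)) ^ (1 / 2 : ℝ) ≤ (L : ℝ) ^ (1 / 2 : ℝ) * rt := by
      have e : (ℓ : ℝ) / ((L ^ m * L ^ k : ℕ) : ℝ) = ((L : ℝ) ^ j₀)⁻¹ := by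
        have hℓ0 : (ℓ : ℝ) ≠ 0 := by exact_mod_cast (by omega : ℓ ≠ 0)
        rw [hℓfac]
        push_cast
        rw [← div_div, div_self hℓ0, one_div]
      rw [e, hrt, hncast, show (1 / (8 * ((d : ℝ) + 1))) = 1 / (2 * (((4 * (d + 1) : ℕ) : ℝ))) by push_cast; ring]
      exact pow_rpow_neg_half_le hLr1 (by positivity) hklt
    calc Real.sqrt ((((L ^ j₀ : ℕ) : ℝ)) ^ (d + 1)) * (C₂ * r * ((L ^ k : ℕ) : ℝ) ^ (-((1 : ℝ) / 2 / 2)))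
          + 2 * ((d : ℝ) + 1) * Real.exp δ ^ (d + 1) * (2 * C₄ * r * ((ℓ : ℝ) / ((L ^ m * L ^ k : ℕ) : ℝ)) ^ (1 / 2 : ℝ))
        ≤ C₂ * r * rt + 2 * ((d : ℝ) + 1) * Real.exp δ ^ (d + 1) * (2 * C₄ * r * ((L : ℝ) ^ (1 / 2 : ℝ) * rt)) := by
          gcongr
      _ = (Cbig - 2 * C₀ * L) * r * rt := by rw [hCbig]; ring
      _ ≤ (Cbig + 1) * r * rt := mul_le_mul_of_nonneg_right (mul_le_mul_of_nonneg_right (by nlinarith [hC₀.le, hLr0.le]) hr) hrt0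
  · -- `k < 8(d+1)`: the a-priori bound `(∇′G′ row)∘diagK 2r`, `1 ≤ L·rt`
    have hG'D := hasMaj_grad_of_ineq (L := L) (MP (paramsOf d L mT k hL')) k (L ^ m * L ^ k) a hn'1 HP' hC₀.le ν
    have hap := hasMaj_comp_diagK_const (g := unitTorusGeo L k (MP (paramsOf d L mT k hL'))) _ (blkFine L k (MP (paramsOf d L mT k hL'))) hC₀.le hG'D hfit
    have hLrt : 1 ≤ (L : ℝ) * rt := by
      rw [hrt, hncast, ← Real.rpow_natCast (L : ℝ) k, ← Real.rpow_mul hLr0.le]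
      have e : (L : ℝ) * (L : ℝ) ^ ((k : ℝ) * -(1 / (8 * ((d : ℝ) + 1)))) = (L : ℝ) ^ (1 + (k : ℝ) * -(1 / (8 * ((d : ℝ) + 1)))) := by
        rw [Real.rpow_add hLr0, Real.rpow_one]
      rw [e]
      refine Real.one_le_rpow hLr1 ?_
      have hk8 : (k : ℝ) < 8 * ((d : ℝ) + 1) := by
        have : ((k : ℕ) : ℝ) < ((8 * (d + 1) : ℕ) : ℝ) := by exact_mod_cast (by omega : k < 8 * (d + 1))
        push_cast at this; linarith
      have hpos : (0 : ℝ) < 8 * ((d : ℝ) + 1) := by positivity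
      rw [show (k : ℝ) * -(1 / (8 * ((d : ℝ) + 1))) = -((k : ℝ) / (8 * ((d : ℝ) + 1))) by ring]
      have : (k : ℝ) / (8 * ((d : ℝ) + 1)) < 1 := by rw [div_lt_one hpos]; exact hk8
      linarith
    refine hap.mono fun y y' => ?_
    rw [← hrt]
    calc C₀ * (2 * r) * Real.exp (-(δ₅ * tdistT (MP (paramsOf d L mT k hL')) y y')) ≤ C₀ * (2 * r) * Real.exp (-(δ * tdistT (MP (paramsOf d L mT k hL')) y y')) :=
          mul_le_mul_of_nonneg_left (Real.exp_le_exp.mpr (neg_le_neg (mul_le_mul_of_nonneg_right hδ5 (tdistT_nonneg _ y y')))) (by positivity)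
      _ ≤ C₀ * (2 * r) * ((L : ℝ) * rt) * Real.exp (-(δ * tdistT (MP (paramsOf d L mT k hL')) y y')) := by
          have h0 : 0 ≤ C₀ * (2 * r) * Real.exp (-(δ * tdistT (MP (paramsOf d L mT k hL')) y y')) := by positivity
          nlinarith
      _ = (2 * C₀ * L) * r * rt * Real.exp (-(δ * tdistT (MP (paramsOf d L mT k hL')) y y')) := by ring
      _ ≤ (Cbig + 1) * r * rt * Real.exp (-(δ * tdistT (MP (paramsOf d L mT k hL')) y y')) := by
          refine mul_le_mul_of_nonneg_right (mul_le_mul_of_nonneg_right (mul_le_mul_of_nonneg_right ?_ hr) hrt0) (hE y y')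
          rw [hCbig]
          have : 0 ≤ C₂ + 2 * ((d : ℝ) + 1) * Real.exp δ ^ (d + 1) * (2 * C₄ * (L : ℝ) ^ (1 / 2 : ℝ)) := by positivity
          linarith

end Summit.QuantumFields.YangMills.BalabanUVNodes.N15.TwoGrid

end
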